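import Summits.Ventures.LatticeQCDFlow.Scoring.SUNOnePlaquetteBesselSeries
import Literature.MathematicalPhysics.QuantumLattice.GaugeGroupsProofs
import HarnessLib

/-!
# The one-plaquette matrix `M = ∫ ρ(g) w(g) dg` commutes with the representation; for the defining representations of `U(N)` and `SU(N)` it is the SCALAR `(N⁻¹ ∫ Re tr g · w(g) dg)·1`

HONEST FRAMING: exact (Metropolis-corrected) sampling algorithms for lattice gauge theory;
figures of merit are autocorrelation/cost numbers at stated couplings and volumes; no
continuum-physics claim.

Venture `LatticeQCDFlow` (cell pub-lqcd), sub-topic `Scoring`; FANOUT row 5 (`s0-sun-a`), GEN-18.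
NEW WORK of the cell (placement rule); part III of the lead's NOT-TYPED item "general-`N` free-boundary area
law".  Parts I/II (`Scoring/NonabelianAreaLaw2D`, `…WilsonLoop`) prove, for every compact gauge group `G`,
continuous representation `ρ : G →* M_N(ℂ)` and continuous class weight `w`, the matrix area law
`∫ ρ(W_{R×T})_{ab} ∏_p w(U_p) dHaar^{⊗E} = (M^{RT})_{ab}` with the ONE-PLAQUETTE MATRIX
`M_{kl} = ∫ ρ(g)_{kl} w(g) dg`.  The scalar Wilson loop `N⁻¹ Re tr ρ(W)` then obeys the exact area law
`⟨W_{R×T}⟩ = (c/∫w)^{RT}` as soon as `M = c·1`.  This file supplies `M = c·1` WITHOUT Schur's lemma or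
Peter–Weyl, from two explicit Weyl-group elements:

* §1 **`rep_mul_integralMatrix_comm`** (every compact `G`, continuous `ρ`, continuous class function `w`):
  `ρ(g) · M = M · ρ(g)` for every `g` — conjugation invariance of the Haar probability (as left × right
  invariance) and the class property of `w`;
* §2 `integralMatrix_apply_eq_zero_of_ne` — if some `ρ(g)` is the diagonal matrix `diag(…, i, …, −i, …)`
  (`i` at `k`, `i⁻¹` at `l`; the tree's `pairFun k l I`), then `M_{kl} = 0`;
  `integralMatrix_apply_diag_eq` — if some `ρ(g)` is the signed transposition `sSwapMatrix k l` of the tree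
  (`Literature…GaugeGroupsProofs`, Bröcker–tom Dieck IV (3.3)), then `M_{kk} = M_{ll}`;
  **`integralMatrix_eq_smul_one`** — with both for all `k ≠ l`: `M = (N⁻¹ ∫ tr ρ(g) · w(g) dg) · 1`;
  `integral_trace_mul_eq_ofReal` — for a UNITARY-valued `ρ` and an inversion-symmetric weight the scalar
  is REAL: `∫ tr ρ(g) w(g) dg = ∫ Re tr ρ(g) · w(g) dg`;
* §3 **`specialUnitary_integralMatrix_eq_smul_one`**, **`unitary_integralMatrix_eq_smul_one`** — for
  `G = SU(N)` resp. `U(N)` in the defining representation (`fundamentalRep`, `unitaryFundamentalRep`) and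
  ANY weight `w(g) = F(Re tr g)` with `F` continuous (the Wilson weight `e^{−β(N − Re tr g)}` of theory-2 at
  any real `β` is `F(x) = e^{−β(N−x)}`):
  `∫ g_{kl} F(Re tr g) dg = δ_{kl} · N⁻¹ ∫ Re tr g · F(Re tr g) dg` — the one-plaquette matrix is the real
  scalar `N⁻¹ ∫ Re tr g · F(Re tr g) dg`, i.e. `(∫ F(Re tr g) dg) × (the one-plaquette plaquette)`, whose
  closed Bessel forms for every `N` are row 5 GEN-17's `UNOnePlaquetteBesselDeterminant` /
  `SUNOnePlaquetteBesselSeries` / `OnePlaquetteHaarMGF`.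

Part IV combines §3 with part II into `⟨W_{R×T}⟩_{open, β} = P_N(β)^{RT}` for `U(N)` and `SU(N)`.
No `def`, nothing cited as a fact, 0 sorry.
-/

noncomputable section

open MeasureTheory Matrix Complex Finset
open scoped ComplexConjugate
open Literature.MathematicalPhysics.QuantumFieldTheory (haarProbability)
open Literature.MathematicalPhysics.QuantumLattice

namespace Summit.Ventures.LatticeQCDFlow.Scoring

/-! ## §1. The one-plaquette matrix commutes with the representation -/

section General

variable {G : Type*} [Group G] [TopologicalSpace G] [IsTopologicalGroup G] [CompactSpace G]
  [MeasurableSpace G] [BorelSpace G] {N : ℕ}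

/-- Continuous functions on a compact group are Haar-integrable. -/
theorem integrable_haarProbability_of_continuous {E : Type*} [NormedAddCommGroup E]
    [SecondCountableTopology E] {f : G → E} (hf : Continuous f) : Integrable f (haarProbability G) :=
  hf.integrable_of_hasCompactSupport (HasCompactSupport.of_compactSpace f)

/-- Conjugation invariance of the Haar probability, Bochner form: `∫ f(g u g⁻¹) du = ∫ f(u) du`. -/
theorem integral_conj_haarProbability_eq {E : Type*} [NormedAddCommGroup E] [NormedSpace ℝ E]
    (f : G → E) (g : G) :
    ∫ u, f (g * u * g⁻¹) ∂(haarProbability G) = ∫ u, f u ∂(haarProbability G) := by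
  have h := integral_mul_right_eq_self (μ := haarProbability G) (fun x => f (g * x)) g⁻¹
  simp only [← mul_assoc] at h
  rw [h]
  exact integral_mul_left_eq_self f g

/-- **The one-plaquette matrix commutes with the representation.**  For a continuous representation
`ρ : G →* M_N(ℂ)` of a compact group and a continuous CLASS function `w`, the matrix
`M_{kl} = ∫ ρ(u)_{kl} w(u) du` satisfies `ρ(g) M = M ρ(g)` for every `g`
(`ρ(g) M ρ(g)⁻¹ = ∫ ρ(g u g⁻¹) w(u) du = ∫ ρ(v) w(g⁻¹ v g) dv = M`). -/
theorem rep_mul_integralMatrix_comm (ρ : G →* Matrix (Fin N) (Fin N) ℂ) (hρ : Continuous ρ)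
    {w : G → ℝ} (hw : Continuous w) (hwc : ∀ k g, w (k * g * k⁻¹) = w g) (g : G) :
    ρ g * (Matrix.of fun k l : Fin N => ∫ u, ρ u k l * (w u : ℂ) ∂(haarProbability G)) =
      (Matrix.of fun k l : Fin N => ∫ u, ρ u k l * (w u : ℂ) ∂(haarProbability G)) * ρ g := by
  set M : Matrix (Fin N) (Fin N) ℂ :=
    Matrix.of fun k l : Fin N => ∫ u, ρ u k l * (w u : ℂ) ∂(haarProbability G) with hM
  have hcont : ∀ a b : Fin N, Continuous fun u : G => ρ u a b * (w u : ℂ) := fun a b =>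
    (hρ.matrix_elem a b).mul (continuous_ofReal.comp hw)
  have key : ρ g * M * ρ g⁻¹ = M := by
    ext k l
    -- the conjugated integrand, expanded in entries
    have h2 : ∀ u : G, ρ (g * u * g⁻¹) k l * (w (g * u * g⁻¹) : ℂ) =
        ∑ b, ∑ a, ρ g k a * (ρ u a b * (w u : ℂ)) * ρ g⁻¹ b l := by
      intro u
      rw [hwc, map_mul, map_mul, Matrix.mul_apply, Finset.sum_mul]
      refine Finset.sum_congr rfl fun b _ => ?_
      rw [Matrix.mul_apply, Finset.sum_mul, Finset.sum_mul]
      refine Finset.sum_congr rfl fun a _ => ?_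
      ring
    have h3 : ∫ u, (∑ b, ∑ a, ρ g k a * (ρ u a b * (w u : ℂ)) * ρ g⁻¹ b l) ∂(haarProbability G) =
        ∑ b, ∑ a, ρ g k a * (∫ u, ρ u a b * (w u : ℂ) ∂(haarProbability G)) * ρ g⁻¹ b l := by
      rw [integral_finsetSum _ fun b _ => integrable_finsetSum _ fun a _ =>
        ((integrable_haarProbability_of_continuous (hcont a b)).const_mul _).mul_const _]
      refine Finset.sum_congr rfl fun b _ => ?_
      rw [integral_finsetSum _ fun a _ =>
        ((integrable_haarProbability_of_continuous (hcont a b)).const_mul _).mul_const _]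
      refine Finset.sum_congr rfl fun a _ => ?_
      rw [integral_mul_const, integral_const_mul]
    rw [Matrix.mul_apply]
    simp_rw [Matrix.mul_apply]
    simp only [hM, Matrix.of_apply]
    rw [← integral_conj_haarProbability_eq (fun u => ρ u k l * (w u : ℂ)) g,
      integral_congr_ae (ae_of_all _ h2), h3]
    exact Finset.sum_congr rfl fun b _ => Finset.sum_mul _ _ _
  calc ρ g * M = ρ g * M * ρ g⁻¹ * ρ g := by
        rw [Matrix.mul_assoc (ρ g * M), ← map_mul, inv_mul_cancel, map_one, Matrix.mul_one]
    _ = M * ρ g := by rw [key]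

/-! ## §2. Two Weyl elements make the one-plaquette matrix scalar -/

/-- If some `ρ(g)` is `diag(…, i (at k), …, i⁻¹ (at l), …)` then `M_{kl} = 0` (`k ≠ l`):
`i M_{kl} = M_{kl} i⁻¹`. -/
theorem integralMatrix_apply_eq_zero_of_ne (ρ : G →* Matrix (Fin N) (Fin N) ℂ) (hρ : Continuous ρ)
    {w : G → ℝ} (hw : Continuous w) (hwc : ∀ k g, w (k * g * k⁻¹) = w g) {k l : Fin N} (hkl : k ≠ l)
    (hD : ∃ g : G, ρ g = diagonal (pairFun k l I)) :
    (Matrix.of fun k l : Fin N => ∫ u, ρ u k l * (w u : ℂ) ∂(haarProbability G)) k l = 0 := by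
  obtain ⟨g, hg⟩ := hD
  have h := rep_mul_integralMatrix_comm ρ hρ hw hwc g
  rw [hg] at h
  have hkl' := congrFun (congrFun h k) l
  rw [Matrix.diagonal_mul, Matrix.mul_diagonal] at hkl'
  have hk : pairFun k l I k = I := by simp [pairFun, hkl]
  have hl : pairFun k l I l = I⁻¹ := by simp [pairFun, Ne.symm hkl]
  rw [hk, hl, Complex.inv_I] at hkl'
  have h2 : (2 * I) * (Matrix.of fun k l : Fin N => ∫ u, ρ u k l * (w u : ℂ) ∂(haarProbability G)) k l
      = 0 := by
    linear_combination hkl'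
  exact (mul_eq_zero.mp h2).resolve_left (mul_ne_zero two_ne_zero I_ne_zero)

/-- If some `ρ(g)` is the signed transposition `sSwapMatrix k l` then `M_{kk} = M_{ll}`. -/
theorem integralMatrix_apply_diag_eq (ρ : G →* Matrix (Fin N) (Fin N) ℂ) (hρ : Continuous ρ)
    {w : G → ℝ} (hw : Continuous w) (hwc : ∀ k g, w (k * g * k⁻¹) = w g) {k l : Fin N} (hkl : k ≠ l)
    (hS : ∃ g : G, ρ g = sSwapMatrix k l) :
    (Matrix.of fun k l : Fin N => ∫ u, ρ u k l * (w u : ℂ) ∂(haarProbability G)) k k =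
      (Matrix.of fun k l : Fin N => ∫ u, ρ u k l * (w u : ℂ) ∂(haarProbability G)) l l := by
  obtain ⟨g, hg⟩ := hS
  set M : Matrix (Fin N) (Fin N) ℂ :=
    Matrix.of fun k l : Fin N => ∫ u, ρ u k l * (w u : ℂ) ∂(haarProbability G) with hM
  have h := rep_mul_integralMatrix_comm ρ hρ hw hwc g
  rw [hg, sSwapMatrix, if_neg hkl] at h
  have hkl' := congrFun (congrFun h k) l
  have hL : (diagonal (Function.update (1 : Fin N → ℂ) k (-1)) * Matrix.swap ℂ k l * M) k l = -M l l := by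
    rw [Matrix.mul_assoc, Matrix.diagonal_mul, Matrix.swap_mul_apply_left, Function.update_self]
    ring
  have hR : (M * (diagonal (Function.update (1 : Fin N → ℂ) k (-1)) * Matrix.swap ℂ k l)) k l = -M k k := by
    rw [← Matrix.mul_assoc, Matrix.mul_swap_apply_right, Matrix.mul_diagonal, Function.update_self]
    ring
  rw [hL, hR] at hkl'
  linear_combination hkl'

/-- **The one-plaquette matrix is scalar.**  If for all `k ≠ l` the image of `ρ` contains
`diag(…, i, …, i⁻¹, …)` and the signed transposition `sSwapMatrix k l`, then
`M = (N⁻¹ ∫ tr ρ(u) · w(u) du) · 1`. -/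
theorem integralMatrix_eq_smul_one (ρ : G →* Matrix (Fin N) (Fin N) ℂ) (hρ : Continuous ρ)
    {w : G → ℝ} (hw : Continuous w) (hwc : ∀ k g, w (k * g * k⁻¹) = w g)
    (hD : ∀ k l : Fin N, k ≠ l → ∃ g : G, ρ g = diagonal (pairFun k l I))
    (hS : ∀ k l : Fin N, k ≠ l → ∃ g : G, ρ g = sSwapMatrix k l) :
    (Matrix.of fun k l : Fin N => ∫ u, ρ u k l * (w u : ℂ) ∂(haarProbability G)) =
      ((N : ℂ)⁻¹ * ∫ u, (ρ u).trace * (w u : ℂ) ∂(haarProbability G)) •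
        (1 : Matrix (Fin N) (Fin N) ℂ) := by
  rcases Nat.eq_zero_or_pos N with hN | hN
  · subst hN
    exact Subsingleton.elim _ _
  set M : Matrix (Fin N) (Fin N) ℂ :=
    Matrix.of fun k l : Fin N => ∫ u, ρ u k l * (w u : ℂ) ∂(haarProbability G) with hM
  have hdiag : ∀ k : Fin N, M k k = M ⟨0, hN⟩ ⟨0, hN⟩ := fun k => by
    by_cases hk : k = ⟨0, hN⟩
    · rw [hk]
    · exact integralMatrix_apply_diag_eq ρ hρ hw hwc hk (hS _ _ hk)
  have hcont : ∀ a b : Fin N, Continuous fun u : G => ρ u a b * (w u : ℂ) := fun a b =>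
    (hρ.matrix_elem a b).mul (continuous_ofReal.comp hw)
  have htr : ∫ u, (ρ u).trace * (w u : ℂ) ∂(haarProbability G) = N * M ⟨0, hN⟩ ⟨0, hN⟩ := by
    have h1 : ∀ u : G, (ρ u).trace * (w u : ℂ) = ∑ k, ρ u k k * (w u : ℂ) := fun u => by
      rw [Matrix.trace, Finset.sum_mul]
      rfl
    simp_rw [h1]
    rw [integral_finsetSum _ fun k _ => integrable_haarProbability_of_continuous (hcont k k)]
    have h2 : ∀ k : Fin N, ∫ u, ρ u k k * (w u : ℂ) ∂(haarProbability G) = M ⟨0, hN⟩ ⟨0, hN⟩ :=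
      fun k => by rw [← hdiag k, hM, Matrix.of_apply]
    simp only [h2, Finset.sum_const, Finset.card_univ, Fintype.card_fin, nsmul_eq_mul]
  ext k l
  rw [Matrix.smul_apply, Matrix.one_apply]
  split_ifs with hkl
  · subst hkl
    rw [smul_eq_mul, mul_one, htr, ← mul_assoc, inv_mul_cancel₀ (Nat.cast_ne_zero.mpr (by omega)),
      one_mul, hdiag]
  · rw [smul_zero]
    exact integralMatrix_apply_eq_zero_of_ne ρ hρ hw hwc hkl (hD k l hkl)

/-- **The scalar is real** for a UNITARY-valued representation (`ρ(u)ᴴ = ρ(u⁻¹)`) and an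
inversion-symmetric weight (`w(u⁻¹) = w(u)`): `∫ tr ρ(u) · w(u) du = ∫ Re tr ρ(u) · w(u) du`
(inversion invariance of Haar: the integral equals its own conjugate). -/
theorem integral_trace_mul_eq_ofReal (ρ : G →* Matrix (Fin N) (Fin N) ℂ) (hρ : Continuous ρ)
    (hρu : ∀ u, (ρ u)ᴴ = ρ u⁻¹) {w : G → ℝ} (hw : Continuous w) (hwi : ∀ u, w u⁻¹ = w u) :
    ∫ u, (ρ u).trace * (w u : ℂ) ∂(haarProbability G) =
      ((∫ u, (ρ u).trace.re * w u ∂(haarProbability G) : ℝ) : ℂ) := by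
  have hcont : Continuous fun u : G => (ρ u).trace * (w u : ℂ) :=
    ((continuous_id.matrix_trace.comp hρ)).mul (continuous_ofReal.comp hw)
  set c := ∫ u, (ρ u).trace * (w u : ℂ) ∂(haarProbability G) with hc
  have hconj : conj c = c := by
    rw [hc, ← integral_conj]
    have h1 : ∀ u : G, conj ((ρ u).trace * (w u : ℂ)) = (ρ u⁻¹).trace * (w u⁻¹ : ℂ) := fun u => by
      rw [map_mul, Complex.conj_ofReal, hwi, ← hρu, Matrix.trace_conjTranspose, Complex.star_def]
    simp_rw [h1]
    exact integral_inv_eq_self (fun u => (ρ u).trace * (w u : ℂ)) (haarProbability G)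
  have hre : c.re = ∫ u, (ρ u).trace.re * w u ∂(haarProbability G) := by
    rw [hc]
    have h := integral_re (integrable_haarProbability_of_continuous hcont)
    simp only [RCLike.re_to_complex] at h
    rw [← h]
    refine integral_congr_ae (ae_of_all _ fun u => ?_)
    simp only [Complex.mul_re, Complex.ofReal_re, Complex.ofReal_im, mul_zero, sub_zero]
  rw [← hre]
  exact (Complex.conj_eq_iff_re.mp hconj).symm

end General

/-! ## §3. The defining representations of `SU(N)` and `U(N)` -/

section SpecialUnitary

variable {N : ℕ}

/-- The circle element `i`. -/
private theorem coe_circle_I : ((circleOfNormEqOne I (by simp) : Circle) : ℂ) = I := rfl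

/-- **`SU(N)`: THE ONE-PLAQUETTE MATRIX IS SCALAR.**  For every `N` and every weight `F(Re tr g)` with
`F` continuous: `∫_{SU(N)} g_{kl} F(Re tr g) dg = δ_{kl} · N⁻¹ ∫ Re tr g · F(Re tr g) dg`. -/
theorem specialUnitary_integralMatrix_eq_smul_one (N : ℕ) {F : ℝ → ℝ} (hF : Continuous F) :
    (Matrix.of fun k l : Fin N => ∫ u, (u : Matrix (Fin N) (Fin N) ℂ) k l *
        (F (u : Matrix (Fin N) (Fin N) ℂ).trace.re : ℂ) ∂(haarProbability (Matrix.specialUnitaryGroup (Fin N) ℂ))) =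
      (((N : ℝ)⁻¹ * ∫ u, (u : Matrix (Fin N) (Fin N) ℂ).trace.re * F (u : Matrix (Fin N) (Fin N) ℂ).trace.re
          ∂(haarProbability (Matrix.specialUnitaryGroup (Fin N) ℂ)) : ℝ) : ℂ) •
        (1 : Matrix (Fin N) (Fin N) ℂ) := by
  have hw : Continuous fun u : Matrix.specialUnitaryGroup (Fin N) ℂ =>
      F (u : Matrix (Fin N) (Fin N) ℂ).trace.re :=
    hF.comp (Complex.continuous_re.comp ((continuous_id.matrix_trace).comp continuous_subtype_val))
  have hwc : ∀ k g : Matrix.specialUnitaryGroup (Fin N) ℂ,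
      F ((k * g * k⁻¹ : Matrix.specialUnitaryGroup (Fin N) ℂ) : Matrix (Fin N) (Fin N) ℂ).trace.re =
        F (g : Matrix (Fin N) (Fin N) ℂ).trace.re := fun k g => by
    rw [trace_conj_specialUnitaryGroup]
  have h := integralMatrix_eq_smul_one (fundamentalRep (Fin N)) (continuous_fundamentalRep (Fin N)) hw hwc
    (fun k l hkl => ⟨dPairHom k l (circleOfNormEqOne I (by simp)), by
      rw [fundamentalRep_apply, coe_dPairHom, coe_circle_I]⟩)
    (fun k l _ => ⟨sSwap k l, by rw [fundamentalRep_apply, coe_sSwap]⟩)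
  have hreal := integral_trace_mul_eq_ofReal (fundamentalRep (Fin N)) (continuous_fundamentalRep (Fin N))
    (fun u => rfl) hw (fun u => by
      show F (star (u : Matrix (Fin N) (Fin N) ℂ)).trace.re = F (u : Matrix (Fin N) (Fin N) ℂ).trace.re
      rw [Matrix.star_eq_conjTranspose, Matrix.trace_conjTranspose, Complex.star_def, Complex.conj_re])
  simp only [fundamentalRep_apply] at h hreal
  rw [h, hreal]
  congr 1
  push_cast
  ring

end SpecialUnitary

section Unitary

variable {N : ℕ}

/-- **`U(N)`: THE ONE-PLAQUETTE MATRIX IS SCALAR.**  For every `N` and every weight `F(Re tr g)` with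
`F` continuous: `∫_{U(N)} g_{kl} F(Re tr g) dg = δ_{kl} · N⁻¹ ∫ Re tr g · F(Re tr g) dg`. -/
theorem unitary_integralMatrix_eq_smul_one (N : ℕ) {F : ℝ → ℝ} (hF : Continuous F) :
    (Matrix.of fun k l : Fin N => ∫ u, (u : Matrix (Fin N) (Fin N) ℂ) k l *
        (F (u : Matrix (Fin N) (Fin N) ℂ).trace.re : ℂ) ∂(haarProbability (Matrix.unitaryGroup (Fin N) ℂ))) =
      (((N : ℝ)⁻¹ * ∫ u, (u : Matrix (Fin N) (Fin N) ℂ).trace.re * F (u : Matrix (Fin N) (Fin N) ℂ).trace.re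
          ∂(haarProbability (Matrix.unitaryGroup (Fin N) ℂ)) : ℝ) : ℂ) •
        (1 : Matrix (Fin N) (Fin N) ℂ) := by
  have hw : Continuous fun u : Matrix.unitaryGroup (Fin N) ℂ => F (u : Matrix (Fin N) (Fin N) ℂ).trace.re :=
    hF.comp (Complex.continuous_re.comp ((continuous_id.matrix_trace).comp continuous_subtype_val))
  have hwc : ∀ k g : Matrix.unitaryGroup (Fin N) ℂ,
      F ((k * g * k⁻¹ : Matrix.unitaryGroup (Fin N) ℂ) : Matrix (Fin N) (Fin N) ℂ).trace.re =
        F (g : Matrix (Fin N) (Fin N) ℂ).trace.re := fun k g => by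
    rw [trace_conj_unitaryGroup]
  have h := integralMatrix_eq_smul_one (unitaryFundamentalRep (Fin N) ℂ)
    (continuous_unitaryFundamentalRep (Fin N) ℂ) hw hwc
    (fun k l hkl => ⟨⟨_, Matrix.specialUnitaryGroup_le_unitaryGroup
        (dPairHom k l (circleOfNormEqOne I (by simp))).2⟩, by
      rw [unitaryFundamentalRep_apply]
      show ((dPairHom k l (circleOfNormEqOne I (by simp)) : Matrix.specialUnitaryGroup (Fin N) ℂ) :
          Matrix (Fin N) (Fin N) ℂ) = _
      rw [coe_dPairHom, coe_circle_I]⟩)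
    (fun k l _ => ⟨⟨sSwapMatrix k l, Matrix.specialUnitaryGroup_le_unitaryGroup (sSwapMatrix_mem k l)⟩, by
      rw [unitaryFundamentalRep_apply]⟩)
  have hreal := integral_trace_mul_eq_ofReal (unitaryFundamentalRep (Fin N) ℂ)
    (continuous_unitaryFundamentalRep (Fin N) ℂ) (fun u => rfl) hw (fun u => by
      show F (star (u : Matrix (Fin N) (Fin N) ℂ)).trace.re = F (u : Matrix (Fin N) (Fin N) ℂ).trace.re
      rw [Matrix.star_eq_conjTranspose, Matrix.trace_conjTranspose, Complex.star_def, Complex.conj_re])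
  simp only [unitaryFundamentalRep_apply] at h hreal
  rw [h, hreal]
  congr 1
  push_cast
  ring

end Unitary

end Summit.Ventures.LatticeQCDFlow.Scoring
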